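import Summits.QuantumFields.BalabanUV.Beta.GAN24.ContactLambdaCommutator
import Summits.QuantumFields.BalabanUV.Beta.GAN24.Push3LambdaKernelCells
import Summits.QuantumFields.BalabanUV.Beta.GAN24.TaylorLamBracket

/-!
# `GAN24.ContactLambdaCellFactorised` — CT-ROUTE, BORNSEC-PLAN v1 §0 (c1)–(c3) ∕ §A (Λ-C) socket re-reading (row owner gan24-p1-g20): THE Λ ONE-GAUGE CELL OF
# `Push3LambdaKernelCells.contact_lambda_eq_cells` FACTORISES OVER THE COARSE BOND — (bracket of the index leg against the Lagrange coefficient) × (commutator of the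
# rooted block averaging with the gauge function, acting on the other leg) — and the bracket of a TENT coefficient is the pairing of the STRAIGHT block sum of the index leg

HONEST FRAMING (cell charter, verbatim): «discharging `BetaPertH` makes Bałaban's UV stability UNCONDITIONAL — a real constructive-QFT result;
it is NOT the continuum limit and NOT the Clay problem.»  DERIVED cell leaf (pub-balaban, G-an2-4 formalisation swarm → CRUX TEAM (2), seat
`b2b-balaban-gan24-formalise-leaf-02`, gen 48): [folklore] bookkeeping (finite-support and dominated exchanges of sums) over this lineage's `ContactLambdaCommutator` ∕
`ContactOneGaugeCellLambda` ∕ `Push3LambdaKernelCells`, road S3's Fubini brick `TaylorLamBracket.summable_uncurry_of_fibre_bound`, road W3's path lemma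
`TaylorTrilinearLattice.abs_sub_le_of_unit_steps` and an2's `KKTFluctuationEnergy.lip1_contourSumAdj` BY NAME; NO cited fact, NO `def`, NO `def … : Prop`, NO sorry, NO wall binder;
legs ∕ coefficient ∕ gauge functions ARBITRARY under the displayed letters.  Discharges NO letter of (CONV-C): it re-reads the landed Λ cells in the form the owner's ruling
R-gan24p1-g20-1 ∕ words (W4)(W7)(W10) and `BORNSEC-PLAN-v1.md` §0 (c1)–(c3) use (vertex∕bracket factor = where the tent `RespStepEffectiveEL.lamCoeffK_KInvStep_E2_eq_neg_contourSumAdj` ∕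
`HΦcol_pair_respStep` act; commutator factor = where the leg climbs one level); the letters (C2)(C3)(C4), the sums (C5) and the assembly (C6) are NOT here; NEVER «G-an2-4 closed»;
NOT hS0, NOT D1, NOT `BetaPertH`, NOT continuum, NOT Clay.  «not in print; our bookkeeping».
HONEST DEPENDENCY (cell records, verbatim): «continuum YM on T⁴ ⇐ BetaPertH ∧ nine spine estimates (0/9 proved); BetaPertH ⇐ (D1) ∧ (D4) ∧ CAP+tail;
G-an2-4 gates asym, D1 and NE2/3/4.»
ABSOLUTE RULE (cell charter, verbatim): «No internally-minted statement may enter as a cited fact. Every hypothesis is either kernel-proved in this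
package or a verbatim quotation of a PUBLISHED theorem with page reference. The manuscript(s) under audit are NOT citable for their own disputed steps —
they are the thing under adjudication; programme-internal (2001/route/tribunal) claims are never citable.»

## What is proved (box root `ρ = toSite r`; generic `d`; `KΛ(ψ; a; b,z) = −Σ_μ Σ'_y a μ y·((ψ z + ψ(z+e_b) − ψ(L·y+ρ) − ψ(L·y+ρ+L·e_μ))·q¹,ρ_{(μ,y)}(b,z)∕2)`)
* §3 the exchange: **`tsum_sum_mul_sum_tsum_comm`** (leg with summable fine slices × bounded coarse coefficient × kernel supported on `Near`: the `z`-sum and the `(μ,y)`-sum commute — product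
  summability, `Summable.tsum_comm`), **`tsum_sum_leg_mul_lambdaKernel`** `Σ'_z Σ_b R b z·KΛ(ψ; a; b,z) = −(2L^{d+1})⁻¹·Σ_μ Σ'_y a μ y·(linAvgAt ρ (ψ̄•R) L μ y − Ψ̄_ρ(μ,y)·linAvgAt ρ R L μ y)`.
* §4 **`cellLambda_eq_sum_bracket_mul_commutator`**: on the summable class of `contact_lambda_eq_cells` (leg `R` summable fine slices, index leg `W` bounded, coefficient letter
  `|c μ y κ u| ≤ Cc·e^{−δ|L·y−u|₁}`, gauge function of bounded gradient)
  `Σ'_z Σ_b R b z·Σ'_u Σ_κ W κ u·KΛ(ψ; c··κu; b,z) = −(2L^{d+1})⁻¹·Σ_μ Σ'_y ⟨W, c(μ,y;·)⟩·(linAvgAt ρ (ψ̄•R) L μ y − Ψ̄_ρ(μ,y)·linAvgAt ρ R L μ y)`, `⟨W, c(μ,y;·)⟩ = Σ'_u Σ_κ W κ u·c μ y κ u`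
  (`abs_bracket_le`: `≤ (d+1)·CW·Cc·Zl(δ)`); and the SOCKET **`contact_lambda_eq_factorised`**: `contact_lambda_eq_cells`' two cells in this form, under ITS hypotheses (the gradient bounds of
  `λ_L`, `λ_R` come from the leg bounds).
* §5 **`bracket_eq_of_tent`**: if `c μ y κ u = γ·(𝒬ᵀ_L Φ_{μy})_κ(u)` (the shape of `TaylorLamBracket.lamCoeffOf_KInv_eq_neg_contourSumAdj` ∕ `RespStepEffectiveEL.lamCoeffK_KInvStep_E2_eq_neg_contourSumAdj`)
  and `W` is summable in each direction, `⟨W, c(μ,y;·)⟩ = γ·Σ'_{y′} Σ_{κ′} Φ_{μy} κ′ y′·(𝒬_L W)_{κ′}(y′)` — the index leg climbs one level too.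
NOT HERE: the letters of BORNSEC v1 (C2) (tent partner), (C3) (face-jump localisation of the staircase), (C4)–(C6); the V∕H twins (`linSymAt` partner) — same script on word.
Provenance: seat b2b-balaban-gan24-formalise-leaf-02 gen 48 (prover-…-leaf-02-g48-0), 2026-08-21; over the files named above BY NAME.
-/

open Finset
open scoped BigOperators
open Literature.MathematicalPhysics.QuantumFieldTheory.LatticeForm (quo)
open Literature.MathematicalPhysics.QuantumFieldTheory.Balaban1983to89
open Literature.MathematicalPhysics.QuantumFieldTheory.Balaban1983to89.Beta
open AffineAveraging AveragingContours AveragingHessianKernels AveragingContoursRooted AveragingHessianKernelsRooted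
open B12Sec2to5 (l1 l1_nonneg)
open ExpKernelCalculus (Zl Zl_nonneg Zl_pos l1_sub_triangle l1_sub_symm summable_exp_shift tsum_exp_shift)
open InterLevelTransport (SLam)
open KernelWard (divV)
open Summit.QuantumFields.BalabanUV.Beta.LinearGaugeVH (nearBox mem_nearBox summable_of_finsupp)
open Summit.QuantumFields.BalabanUV.Beta.GAN24.ContactBorderPartner (exists_finset_near_card l1_smul_sub_le_of_mem
  l1_farEnd_sub_le_of_mem)
open Summit.QuantumFields.BalabanUV.Beta.GAN24.ContactOneGaugeCellLambda (near_of_linKerAt_ne_zero l1_root_sub_le_of_mem)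
open Summit.QuantumFields.BalabanUV.Beta.GAN24.TaylorLamBracket (summable_uncurry_of_fibre_bound)
open Summit.QuantumFields.BalabanUV.Beta.GAN24.Push3 (push₃)
open Summit.QuantumFields.BalabanUV.Beta.GAN24.Push3LambdaKernelCells (contact_lambda_eq_cells)
open Summit.QuantumFields.BalabanUV.Beta.GAN24.ContactLambdaCommutator (tsum_sum_mul_gaugeWeight_mul_linKerAt abs_gaugeWeight_le prox_of_near)

noncomputable section

namespace Summit.QuantumFields.BalabanUV.Beta.GAN24.ContactLambdaCellFactorised

variable {d : ℕ}

/-! ## §3 The dominated exchange of the leg sum with the coarse coefficient sum; the Λ kernel against a leg -/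

section Exchange

variable {L : ℕ} {r : Fin (d + 1) → ℕ}

/-- [folklore] **THE DOMINATED EXCHANGE OF THE LEG SUM WITH THE COARSE COEFFICIENT SUM.**  For a kernel `K μ y b z` supported on `Near L y z` and
bounded there, a bounded coarse coefficient `a μ y` and a leg `R` with summable fine slices,
`Σ'_z Σ_b R b z · Σ_μ Σ'_y a μ y · K μ y b z = Σ_μ Σ'_y a μ y · Σ'_z Σ_b R b z · K μ y b z` — the family `(z, y) ↦ Σ_b R b z·a μ y·K μ y b z` is
summable on the product (each fine site has at most `2^{d+1}` near coarse sites, `ContactBorderPartner.exists_finset_near_card`; the brick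
`TaylorLamBracket.summable_uncurry_of_fibre_bound`), so `Summable.tsum_comm` applies. -/
theorem tsum_sum_mul_sum_tsum_comm (hL : 1 ≤ L)
    {K : Fin (d + 1) → (Fin (d + 1) → ℤ) → Fin (d + 1) → (Fin (d + 1) → ℤ) → ℝ} {CK : ℝ}
    (hK0 : ∀ μ y b z, ¬ Near L y z → K μ y b z = 0) (hK : ∀ μ y b z, Near L y z → |K μ y b z| ≤ CK)
    {a : Fin (d + 1) → (Fin (d + 1) → ℤ) → ℝ} {Ca : ℝ} (ha : ∀ μ y, |a μ y| ≤ Ca)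
    {R : Form1 (d + 1) ℝ} (hRs : ∀ b, Summable fun z => R b z) :
    ∑' z, ∑ b, R b z * ∑ μ, ∑' y, a μ y * K μ y b z = ∑ μ, ∑' y, a μ y * ∑' z, ∑ b, R b z * K μ y b z := by
  classical
  choose S hScard hSnear _hSprox using fun z : Fin (d + 1) → ℤ => exists_finset_near_card (d := d) hL z
  have hCa : 0 ≤ Ca := (abs_nonneg _).trans (ha 0 0)
  have hN0 : Near L (0 : Fin (d + 1) → ℤ) 0 := fun i => by
    simp only [Pi.zero_apply, mul_zero, zero_add, le_refl, true_and]
    have : (1 : ℤ) ≤ L := by exact_mod_cast hL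
    omega
  have hCK : 0 ≤ CK := (abs_nonneg _).trans (hK 0 0 0 0 hN0)
  -- pointwise facts
  have hzero : ∀ μ b z y, y ∉ S z → a μ y * K μ y b z = 0 := fun μ b z y hy => by
    rw [hK0 μ y b z (fun h => hy (hSnear z y h)), mul_zero]
  have hbd : ∀ μ b z y, |a μ y * K μ y b z| ≤ Ca * CK := by
    intro μ b z y
    by_cases h : Near L y z
    · rw [abs_mul]; exact mul_le_mul (ha μ y) (hK μ y b z h) (abs_nonneg _) hCa
    · rw [hK0 μ y b z h, mul_zero, abs_zero]; exact mul_nonneg hCa hCK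
  have hHzero : ∀ μ z y, y ∉ S z → ∑ b, R b z * (a μ y * K μ y b z) = 0 := fun μ z y hy =>
    Finset.sum_eq_zero fun b _ => by rw [hzero μ b z y hy, mul_zero]
  -- summability of the fine fibres
  have hsy : ∀ μ b z, Summable fun y => R b z * (a μ y * K μ y b z) := fun μ b z =>
    (summable_of_finsupp (S z) (fun y hy => hzero μ b z y hy)).mul_left _
  -- product summability, one `μ` at a time
  have hprod : ∀ μ, Summable (Function.uncurry fun z y => ∑ b, R b z * (a μ y * K μ y b z)) := by
    intro μ
    refine summable_uncurry_of_fibre_bound (a := fun z => ∑ b, |R b z|) (K := 2 ^ (d + 1) * (Ca * CK))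
      (summable_sum fun b _ => (hRs b).abs) (fun z => ?_) (fun z => ?_)
    · exact summable_of_finsupp (S z) fun y hy => by
        show |∑ b, R b z * (a μ y * K μ y b z)| = 0
        rw [hHzero μ z y hy, abs_zero]
    · rw [tsum_eq_sum (s := S z) (fun y hy => by rw [hHzero μ z y hy, abs_zero])]
      have hpt : ∀ y ∈ S z, |∑ b, R b z * (a μ y * K μ y b z)| ≤ (∑ b, |R b z|) * (Ca * CK) := by
        intro y _
        refine (Finset.abs_sum_le_sum_abs _ _).trans ?_
        rw [Finset.sum_mul]
        refine Finset.sum_le_sum fun b _ => ?_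
        rw [abs_mul]
        exact mul_le_mul_of_nonneg_left (hbd μ b z y) (abs_nonneg _)
      have hR0 : 0 ≤ ∑ b, |R b z| := Finset.sum_nonneg fun b _ => abs_nonneg _
      calc ∑ y ∈ S z, |∑ b, R b z * (a μ y * K μ y b z)|
          ≤ ∑ _y ∈ S z, (∑ b, |R b z|) * (Ca * CK) := Finset.sum_le_sum hpt
        _ = (S z).card * ((∑ b, |R b z|) * (Ca * CK)) := by rw [Finset.sum_const, nsmul_eq_mul]
        _ ≤ (2 : ℝ) ^ (d + 1) * ((∑ b, |R b z|) * (Ca * CK)) := by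
            refine mul_le_mul_of_nonneg_right ?_ (mul_nonneg hR0 (mul_nonneg hCa hCK))
            exact_mod_cast hScard z
        _ = abs (∑ b, |R b z|) * (2 ^ (d + 1) * (Ca * CK)) := by rw [abs_of_nonneg hR0]; ring
  -- summability in `z` of the `μ`-slices
  have hsz : ∀ μ, Summable fun z => ∑ b, R b z * ∑' y, a μ y * K μ y b z := by
    intro μ
    refine (hprod μ).prod.congr fun z => ?_
    show ∑' y, ∑ b, R b z * (a μ y * K μ y b z) = ∑ b, R b z * ∑' y, a μ y * K μ y b z
    rw [Summable.tsum_finsetSum (fun b _ => hsy μ b z)]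
    exact Finset.sum_congr rfl fun b _ => tsum_mul_left
  -- the exchange
  have hμ : ∀ μ, ∑' z, ∑ b, R b z * ∑' y, a μ y * K μ y b z = ∑' y, a μ y * ∑' z, ∑ b, R b z * K μ y b z := by
    intro μ
    calc ∑' z, ∑ b, R b z * ∑' y, a μ y * K μ y b z
        = ∑' z, ∑' y, ∑ b, R b z * (a μ y * K μ y b z) := by
          refine tsum_congr fun z => ?_
          rw [Summable.tsum_finsetSum (fun b _ => hsy μ b z)]
          exact Finset.sum_congr rfl fun b _ => tsum_mul_left.symm
      _ = ∑' y, ∑' z, ∑ b, R b z * (a μ y * K μ y b z) := (hprod μ).tsum_comm.symm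
      _ = ∑' y, a μ y * ∑' z, ∑ b, R b z * K μ y b z := by
          refine tsum_congr fun y => ?_
          rw [← tsum_mul_left]
          refine tsum_congr fun z => ?_
          rw [Finset.mul_sum]
          exact Finset.sum_congr rfl fun b _ => by ring
  calc ∑' z, ∑ b, R b z * ∑ μ, ∑' y, a μ y * K μ y b z
      = ∑' z, ∑ μ, ∑ b, R b z * ∑' y, a μ y * K μ y b z := by
        refine tsum_congr fun z => ?_
        simp only [Finset.mul_sum]
        rw [Finset.sum_comm]
    _ = ∑ μ, ∑' z, ∑ b, R b z * ∑' y, a μ y * K μ y b z := Summable.tsum_finsetSum fun μ _ => hsz μ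
    _ = ∑ μ, ∑' y, a μ y * ∑' z, ∑ b, R b z * K μ y b z := Finset.sum_congr rfl fun μ _ => hμ μ

/-- [folklore] **THE Λ CONTACT KERNEL AGAINST A LEG, COMMUTATOR FORM** (box root; coarse coefficient `a` BOUNDED, leg `R` with summable fine slices,
gauge function of bounded gradient): with the kernel `KΛ(ψ; a; b, z) = −Σ_μ Σ'_y a μ y·((ψ z + ψ(z+e_b) − ψ(L·y+ρ) − ψ(L·y+ρ+L·e_μ))·q¹,ρ_{(μ,y)}(b,z)∕2)`
of `Push3LambdaKernelCells` (there `a = c · · κ u`),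
`Σ'_z Σ_b R b z · KΛ(ψ; a; b, z) = −(2L^{d+1})⁻¹ · Σ_μ Σ'_y a μ y · (linAvgAt ρ (ψ̄•R) L μ y − Ψ̄_ρ(μ,y) · linAvgAt ρ R L μ y)`. -/
theorem tsum_sum_leg_mul_lambdaKernel (hL : 1 ≤ L) (hr : r ∈ box (d + 1) L)
    {a : Fin (d + 1) → (Fin (d + 1) → ℤ) → ℝ} {Ca : ℝ} (ha : ∀ μ y, |a μ y| ≤ Ca)
    {R : Form1 (d + 1) ℝ} (hRs : ∀ b, Summable fun z => R b z)
    {ψ : (Fin (d + 1) → ℤ) → ℝ} {G : ℝ} (hψ : ∀ κ x, |dz ψ κ x| ≤ G) :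
    ∑' z, ∑ b, R b z * -(∑ μ, ∑' y, a μ y *
        ((ψ z + ψ (z + unitVec b) - ψ ((L : ℤ) • y + toSite r) - ψ ((L : ℤ) • y + toSite r + (L : ℤ) • unitVec μ))
          * linKerAt (toSite r) L μ y (b, z) / 2))
      = -(2 * (L : ℝ) ^ (d + 1))⁻¹ * ∑ μ, ∑' y, a μ y *
          (linAvgAt (toSite r) (fun b z => (ψ z + ψ (z + unitVec b)) * R b z) L μ y
            - (ψ ((L : ℤ) • y + toSite r) + ψ ((L : ℤ) • y + toSite r + (L : ℤ) • unitVec μ)) * linAvgAt (toSite r) R L μ y) := by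
  have hG : 0 ≤ G := (abs_nonneg _).trans (hψ 0 0)
  -- the kernel `K μ y b z := weight · q¹ ∕ 2`: support and bound
  have hK0 : ∀ μ y b z, ¬ Near L y z →
      (ψ z + ψ (z + unitVec b) - ψ ((L : ℤ) • y + toSite r) - ψ ((L : ℤ) • y + toSite r + (L : ℤ) • unitVec μ))
        * linKerAt (toSite r) L μ y (b, z) / 2 = 0 := fun μ y b z h => by
    rw [linKerAt_eq_zero hr (f := (b, z)) h, mul_zero, zero_div]
  have hK : ∀ μ y b z, Near L y z →
      |(ψ z + ψ (z + unitVec b) - ψ ((L : ℤ) • y + toSite r) - ψ ((L : ℤ) • y + toSite r + (L : ℤ) • unitVec μ))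
        * linKerAt (toSite r) L μ y (b, z) / 2| ≤ G * (2 * (((d : ℝ) + 1) * (2 * (L : ℝ))) + 1) * (ell (d + 1) L : ℝ) / 2 := by
    intro μ y b z h
    rw [abs_div, abs_two, abs_mul]
    refine div_le_div_of_nonneg_right (mul_le_mul (abs_gaugeWeight_le hr hψ (prox_of_near h) b μ)
      (abs_linKerAt_le hL μ y hr (b, z)) (abs_nonneg _) (by positivity)) zero_le_two
  have hx := tsum_sum_mul_sum_tsum_comm hL hK0 hK ha hRs
  -- pull the sign out, exchange, and read each inner pairing as a commutator (§2)
  have hneg : (fun z => ∑ b, R b z * -(∑ μ, ∑' y, a μ y *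
      ((ψ z + ψ (z + unitVec b) - ψ ((L : ℤ) • y + toSite r) - ψ ((L : ℤ) • y + toSite r + (L : ℤ) • unitVec μ))
        * linKerAt (toSite r) L μ y (b, z) / 2))) = fun z => -(∑ b, R b z * ∑ μ, ∑' y, a μ y *
      ((ψ z + ψ (z + unitVec b) - ψ ((L : ℤ) • y + toSite r) - ψ ((L : ℤ) • y + toSite r + (L : ℤ) • unitVec μ))
        * linKerAt (toSite r) L μ y (b, z) / 2)) := by
    funext z
    rw [← Finset.sum_neg_distrib]
    exact Finset.sum_congr rfl fun b _ => mul_neg _ _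
  rw [hneg, tsum_neg, hx, neg_mul, Finset.mul_sum]
  congr 1
  refine Finset.sum_congr rfl fun μ _ => ?_
  rw [← tsum_mul_left]
  refine tsum_congr fun y => ?_
  rw [tsum_sum_mul_gaugeWeight_mul_linKerAt hr ψ R μ y]
  ring

end Exchange

/-! ## §4 The Λ one-gauge cell factorises over the coarse bond: (bracket of the index leg against the coefficient) × (commutator of the leg) -/

section Cell

variable {L : ℕ} {r : Fin (d + 1) → ℕ}

/-- [folklore] A bounded index leg against a coefficient slice decaying in the fine bond is summable. -/
theorem summable_idxLeg_mul_coeff {c : Fin (d + 1) → (Fin (d + 1) → ℤ) → Fin (d + 1) → (Fin (d + 1) → ℤ) → ℝ} {Cc δ : ℝ}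
    (hc : ∀ μ y κ u, |c μ y κ u| ≤ Cc * Real.exp (-δ * l1 ((L : ℤ) • y - u))) (hδ : 0 < δ)
    {W : Form1 (d + 1) ℝ} {CW : ℝ} (hW : ∀ κ u, |W κ u| ≤ CW) (μ : Fin (d + 1)) (y : Fin (d + 1) → ℤ) (κ : Fin (d + 1)) :
    Summable fun u => W κ u * c μ y κ u := by
  have hCc : 0 ≤ Cc := by
    have h := hc 0 0 0 0
    exact nonneg_of_mul_nonneg_left ((abs_nonneg _).trans h) (Real.exp_pos _)
  refine Summable.of_norm_bounded (((summable_exp_shift hδ ((L : ℤ) • y)).mul_left Cc).mul_left CW) fun u => ?_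
  rw [Real.norm_eq_abs, abs_mul]
  exact mul_le_mul (hW κ u) (hc μ y κ u) (abs_nonneg _) ((abs_nonneg _).trans (hW 0 0))

/-- [folklore] **THE BRACKET OF THE INDEX LEG AGAINST THE COEFFICIENT IS BOUNDED** uniformly in the coarse bond:
`|Σ'_u Σ_κ W κ u · c μ y κ u| ≤ (d+1)·CW·Cc·Zl(δ)`. -/
theorem abs_bracket_le {c : Fin (d + 1) → (Fin (d + 1) → ℤ) → Fin (d + 1) → (Fin (d + 1) → ℤ) → ℝ} {Cc δ : ℝ}
    (hc : ∀ μ y κ u, |c μ y κ u| ≤ Cc * Real.exp (-δ * l1 ((L : ℤ) • y - u))) (hδ : 0 < δ)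
    {W : Form1 (d + 1) ℝ} {CW : ℝ} (hW : ∀ κ u, |W κ u| ≤ CW) (μ : Fin (d + 1)) (y : Fin (d + 1) → ℤ) :
    |∑' u, ∑ κ, W κ u * c μ y κ u| ≤ ((d : ℝ) + 1) * (CW * (Cc * Zl (d + 1) δ)) := by
  have hCW : 0 ≤ CW := (abs_nonneg _).trans (hW 0 0)
  have hsc : ∀ κ, Summable fun u => c μ y κ u := fun κ =>
    Summable.of_norm_bounded ((summable_exp_shift hδ ((L : ℤ) • y)).mul_left Cc) fun u => by
      rw [Real.norm_eq_abs]; exact hc μ y κ u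
  have hκ : ∀ κ, |∑' u, W κ u * c μ y κ u| ≤ CW * (Cc * Zl (d + 1) δ) := by
    intro κ
    refine (BalabanCompositeJets.abs_tsum_mul_le (hW κ) (hsc κ)).trans (mul_le_mul_of_nonneg_left ?_ hCW)
    calc ∑' u, |c μ y κ u| ≤ ∑' u, Cc * Real.exp (-δ * l1 ((L : ℤ) • y - u)) :=
          Summable.tsum_le_tsum (fun u => hc μ y κ u) (hsc κ).abs ((summable_exp_shift hδ _).mul_left Cc)
      _ = Cc * Zl (d + 1) δ := by rw [tsum_mul_left, tsum_exp_shift]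
  rw [Summable.tsum_finsetSum (fun κ _ => summable_idxLeg_mul_coeff hc hδ hW μ y κ)]
  calc |∑ κ, ∑' u, W κ u * c μ y κ u| ≤ ∑ κ, |∑' u, W κ u * c μ y κ u| := Finset.abs_sum_le_sum_abs _ _
    _ ≤ ∑ _κ : Fin (d + 1), CW * (Cc * Zl (d + 1) δ) := Finset.sum_le_sum fun κ _ => hκ κ
    _ = ((d : ℝ) + 1) * (CW * (Cc * Zl (d + 1) δ)) := by
        rw [Finset.sum_const, Finset.card_univ, Fintype.card_fin, nsmul_eq_mul]; push_cast; ring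

/-- [folklore] **THE INDEX LEG PASSES THROUGH THE COARSE SUM**: for a coarse family `g μ y` vanishing off a finite set `s`,
`Σ'_u Σ_κ W κ u · (−Σ_μ Σ'_y c μ y κ u · g μ y) = −Σ_μ Σ'_y (Σ'_u Σ_κ W κ u · c μ y κ u) · g μ y` (the `u`-sum against finitely many summable slices). -/
theorem tsum_sum_idxLeg_mul_neg_sum_tsum {c : Fin (d + 1) → (Fin (d + 1) → ℤ) → Fin (d + 1) → (Fin (d + 1) → ℤ) → ℝ} {Cc δ : ℝ}
    (hc : ∀ μ y κ u, |c μ y κ u| ≤ Cc * Real.exp (-δ * l1 ((L : ℤ) • y - u))) (hδ : 0 < δ)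
    {W : Form1 (d + 1) ℝ} {CW : ℝ} (hW : ∀ κ u, |W κ u| ≤ CW)
    {g : Fin (d + 1) → (Fin (d + 1) → ℤ) → ℝ} (s : Finset (Fin (d + 1) → ℤ)) (hg : ∀ μ, ∀ y ∉ s, g μ y = 0) :
    ∑' u, ∑ κ, W κ u * -(∑ μ, ∑' y, c μ y κ u * g μ y) = -(∑ μ, ∑' y, (∑' u, ∑ κ, W κ u * c μ y κ u) * g μ y) := by
  have hsWc := summable_idxLeg_mul_coeff hc hδ hW
  have h1 : ∀ κ u, (∑ μ, ∑' y, c μ y κ u * g μ y) = ∑ μ, ∑ y ∈ s, c μ y κ u * g μ y := fun κ u =>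
    Finset.sum_congr rfl fun μ _ => tsum_eq_sum fun y hy => by rw [hg μ y hy, mul_zero]
  have h2 : ∀ μ, (∑' y, (∑' u, ∑ κ, W κ u * c μ y κ u) * g μ y) = ∑ y ∈ s, (∑' u, ∑ κ, W κ u * c μ y κ u) * g μ y :=
    fun μ => tsum_eq_sum fun y hy => by rw [hg μ y hy, mul_zero]
  have h3 : ∀ u, ∑ κ, W κ u * -(∑ μ, ∑ y ∈ s, c μ y κ u * g μ y) = -(∑ μ, ∑ y ∈ s, (∑ κ, W κ u * c μ y κ u) * g μ y) := by
    intro u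
    simp only [mul_neg, Finset.sum_neg_distrib, Finset.mul_sum, Finset.sum_mul, mul_assoc]
    rw [Finset.sum_comm]
    exact congrArg Neg.neg (Finset.sum_congr rfl fun μ _ => Finset.sum_comm)
  have hs3 : ∀ μ y, Summable fun u => (∑ κ, W κ u * c μ y κ u) * g μ y := fun μ y =>
    (summable_sum fun κ _ => hsWc μ y κ).mul_right _
  simp only [h1, h2, h3]
  rw [tsum_neg, Summable.tsum_finsetSum (fun μ _ => summable_sum fun y _ => hs3 μ y)]
  congr 1
  refine Finset.sum_congr rfl fun μ _ => ?_
  rw [Summable.tsum_finsetSum (fun y _ => hs3 μ y)]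
  exact Finset.sum_congr rfl fun y _ => tsum_mul_right

/-- [folklore] **THE Λ ONE-GAUGE CELL FACTORISES OVER THE COARSE BOND** (the summable class of `Push3LambdaKernelCells.contact_lambda_eq_cells`: leg `R`
with summable fine slices, index leg `W` bounded, coefficient letter `|c μ y κ u| ≤ Cc·e^{−δ|L·y − u|₁}`, gauge function of bounded gradient; box root):
`Σ'_z Σ_b R b z · Σ'_u Σ_κ W κ u · KΛ(ψ; κ,u; b,z) = −(2L^{d+1})⁻¹ · Σ_μ Σ'_y ⟨W, c(μ,y;·)⟩ · (linAvgAt ρ (ψ̄•R) L μ y − Ψ̄_ρ(μ,y) · linAvgAt ρ R L μ y)`,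
`⟨W, c(μ,y;·)⟩ = Σ'_u Σ_κ W κ u · c μ y κ u` — the BRACKET factor is where the Lagrange coefficient is re-read as a tent of the next-level
Hessian column (the owner's `RespStepEffectiveEL.lamCoeffK_KInvStep_E2_eq_neg_contourSumAdj`, §5 below), the COMMUTATOR factor is where the
leg climbs one level (§1's `tsum_sum_linKerAt_mul_eq_contourSum_sub` and the tent `RespStepEffectiveEL.HΦcol_pair_respStep`). -/
theorem cellLambda_eq_sum_bracket_mul_commutator (hL : 1 ≤ L) (hr : r ∈ box (d + 1) L)
    {c : Fin (d + 1) → (Fin (d + 1) → ℤ) → Fin (d + 1) → (Fin (d + 1) → ℤ) → ℝ} {Cc δ : ℝ}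
    (hc : ∀ μ y κ u, |c μ y κ u| ≤ Cc * Real.exp (-δ * l1 ((L : ℤ) • y - u))) (hδ : 0 < δ)
    {R : Form1 (d + 1) ℝ} (hRs : ∀ b, Summable fun z => R b z)
    {W : Form1 (d + 1) ℝ} {CW : ℝ} (hW : ∀ κ u, |W κ u| ≤ CW)
    {ψ : (Fin (d + 1) → ℤ) → ℝ} {G : ℝ} (hψ : ∀ κ x, |dz ψ κ x| ≤ G) :
    ∑' z, ∑ b, R b z * ∑' u, ∑ κ, W κ u *
        -(∑ μ, ∑' y, c μ y κ u *
          ((ψ z + ψ (z + unitVec b) - ψ ((L : ℤ) • y + toSite r) - ψ ((L : ℤ) • y + toSite r + (L : ℤ) • unitVec μ))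
            * linKerAt (toSite r) L μ y (b, z) / 2))
      = -(2 * (L : ℝ) ^ (d + 1))⁻¹ * ∑ μ, ∑' y, (∑' u, ∑ κ, W κ u * c μ y κ u) *
          (linAvgAt (toSite r) (fun b z => (ψ z + ψ (z + unitVec b)) * R b z) L μ y
            - (ψ ((L : ℤ) • y + toSite r) + ψ ((L : ℤ) • y + toSite r + (L : ℤ) • unitVec μ)) * linAvgAt (toSite r) R L μ y) := by
  classical
  -- Step A: the index leg passes through the coarse sum (for each `(b, z)` the `y`-family is finitely supported)
  have hA : ∀ b z, (∑' u, ∑ κ, W κ u * -(∑ μ, ∑' y, c μ y κ u *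
      ((ψ z + ψ (z + unitVec b) - ψ ((L : ℤ) • y + toSite r) - ψ ((L : ℤ) • y + toSite r + (L : ℤ) • unitVec μ))
        * linKerAt (toSite r) L μ y (b, z) / 2)))
      = -(∑ μ, ∑' y, (∑' u, ∑ κ, W κ u * c μ y κ u) *
          ((ψ z + ψ (z + unitVec b) - ψ ((L : ℤ) • y + toSite r) - ψ ((L : ℤ) • y + toSite r + (L : ℤ) • unitVec μ))
            * linKerAt (toSite r) L μ y (b, z) / 2)) := by
    intro b z
    obtain ⟨s, -, hs, -⟩ := exists_finset_near_card (d := d) hL z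
    exact tsum_sum_idxLeg_mul_neg_sum_tsum hc hδ hW s fun μ y hy => by
      rw [linKerAt_eq_zero hr (f := (b, z)) (fun h => hy (hs y h)), mul_zero, zero_div]
  have hA' : (fun z => ∑ b, R b z * ∑' u, ∑ κ, W κ u * -(∑ μ, ∑' y, c μ y κ u *
      ((ψ z + ψ (z + unitVec b) - ψ ((L : ℤ) • y + toSite r) - ψ ((L : ℤ) • y + toSite r + (L : ℤ) • unitVec μ))
        * linKerAt (toSite r) L μ y (b, z) / 2))) = fun z => ∑ b, R b z * -(∑ μ, ∑' y, (∑' u, ∑ κ, W κ u * c μ y κ u) *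
      ((ψ z + ψ (z + unitVec b) - ψ ((L : ℤ) • y + toSite r) - ψ ((L : ℤ) • y + toSite r + (L : ℤ) • unitVec μ))
        * linKerAt (toSite r) L μ y (b, z) / 2)) := by
    funext z
    exact Finset.sum_congr rfl fun b _ => by rw [hA b z]
  rw [hA']
  -- Step B: §3 with the bracket as the coarse coefficient
  exact tsum_sum_leg_mul_lambdaKernel hL hr (abs_bracket_le hc hδ hW) hRs hψ

/-- [folklore] **THE SOCKET RE-READ: `contact_lambda_eq_cells`' TWO Λ CELLS, FACTORISED** (same hypotheses as `Push3LambdaKernelCells.contact_lambda_eq_cells`; the gradient letters of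
`λ_L`, `λ_R` are the leg bounds through `lᴱ − lᴮ = dz λ_L`, `rᴱ − rᴮ = dz λ_R`):
`push₃ lᴱ rᴱ wᴱ SΛ − push₃ lᴮ rᴮ wᴮ SΛ` `(x′,z′,inl α,inl β)`
`= −(2L^{d+1})⁻¹·Σ_μ Σ'_y ⟨wᴱ_{κ′u′}, c(μ,y;·)⟩·[𝒬^ρ_L, λ̄_L αx′] rᴱ_{βz′} (μ,y) + (2L^{d+1})⁻¹·Σ_μ Σ'_y ⟨wᴱ_{κ′u′}, c(μ,y;·)⟩·[𝒬^ρ_L, λ̄_R βz′] lᴮ_{αx′} (μ,y)` (written as the difference of the two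
factorised cells). -/
theorem contact_lambda_eq_factorised {lE lB rE rB wE wB : Fin (d + 1) → (Fin (d + 1) → ℤ) → Fin (d + 1) → (Fin (d + 1) → ℤ) → ℝ}
    {lamL lamR lamW : Fin (d + 1) → (Fin (d + 1) → ℤ) → (Fin (d + 1) → ℤ) → ℝ} {ClE ClB CrE CrB CwE CwB ClamW : ℝ}
    {rr : Fin (d + 1) → ℕ} {c : Fin (d + 1) → (Fin (d + 1) → ℤ) → Fin (d + 1) → (Fin (d + 1) → ℤ) → ℝ} {Cc δ : ℝ}
    (hL : 1 ≤ L) (hrr : rr ∈ box (d + 1) L) (hc : ∀ μ y κ u, |c μ y κ u| ≤ Cc * Real.exp (-δ * l1 ((L : ℤ) • y - u)))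
    (hδ : 0 < δ) (hCc : 0 ≤ Cc) (hdiv : ∀ u, divV (SLam L c (fun μ y => hessFFAt (toSite rr) L μ y)) u = 0)
    (hlE : ∀ α x' κ x, |lE α x' κ x| ≤ ClE) (hlEs : ∀ α x' κ, Summable fun x => lE α x' κ x)
    (hlB : ∀ α x' κ x, |lB α x' κ x| ≤ ClB) (hlBs : ∀ α x' κ, Summable fun x => lB α x' κ x)
    (hrE : ∀ β z' κ z, |rE β z' κ z| ≤ CrE) (hrEs : ∀ β z' κ, Summable fun z => rE β z' κ z)
    (hrB : ∀ β z' κ z, |rB β z' κ z| ≤ CrB) (hrBs : ∀ β z' κ, Summable fun z => rB β z' κ z)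
    (hwE : ∀ κ' u' κ u, |wE κ' u' κ u| ≤ CwE) (hwB : ∀ κ' u' κ u, |wB κ' u' κ u| ≤ CwB)
    (hLg : lE - lB = fun μ y κ u => dz (lamL μ y) κ u) (hRg : rE - rB = fun μ y κ u => dz (lamR μ y) κ u)
    (hWg : wE - wB = fun μ y κ u => dz (lamW μ y) κ u) (hlamW : ∀ μ y u, |lamW μ y u| ≤ ClamW)
    (κ' : Fin (d + 1)) (u' x' z' : Fin (d + 1) → ℤ) (α β : Fin (d + 1)) :
    push₃ lE rE wE (SLam L c (fun μ y => hessFFAt (toSite rr) L μ y)) κ' u' x' z' (Sum.inl α) (Sum.inl β)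
        - push₃ lB rB wB (SLam L c (fun μ y => hessFFAt (toSite rr) L μ y)) κ' u' x' z' (Sum.inl α) (Sum.inl β)
      = -(2 * (L : ℝ) ^ (d + 1))⁻¹ * (∑ μ, ∑' y, (∑' u, ∑ κ, wE κ' u' κ u * c μ y κ u) *
            (linAvgAt (toSite rr) (fun b z => (lamL α x' z + lamL α x' (z + unitVec b)) * rE β z' b z) L μ y
              - (lamL α x' ((L : ℤ) • y + toSite rr) + lamL α x' ((L : ℤ) • y + toSite rr + (L : ℤ) • unitVec μ))
                * linAvgAt (toSite rr) (rE β z') L μ y))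
        - -(2 * (L : ℝ) ^ (d + 1))⁻¹ * (∑ μ, ∑' y, (∑' u, ∑ κ, wE κ' u' κ u * c μ y κ u) *
            (linAvgAt (toSite rr) (fun a x => (lamR β z' x + lamR β z' (x + unitVec a)) * lB α x' a x) L μ y
              - (lamR β z' ((L : ℤ) • y + toSite rr) + lamR β z' ((L : ℤ) • y + toSite rr + (L : ℤ) • unitVec μ))
                * linAvgAt (toSite rr) (lB α x') L μ y)) := by
  -- the gradient letters of the gauge functions from the leg bounds
  have hgL : ∀ κ u, |dz (lamL α x') κ u| ≤ ClE + ClB := fun κ u => by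
    have e : dz (lamL α x') κ u = (lE - lB) α x' κ u := by rw [hLg]
    rw [e, Pi.sub_apply, Pi.sub_apply, Pi.sub_apply, Pi.sub_apply]
    exact (abs_sub _ _).trans (add_le_add (hlE α x' κ u) (hlB α x' κ u))
  have hgR : ∀ κ u, |dz (lamR β z') κ u| ≤ CrE + CrB := fun κ u => by
    have e : dz (lamR β z') κ u = (rE - rB) β z' κ u := by rw [hRg]
    rw [e, Pi.sub_apply, Pi.sub_apply, Pi.sub_apply, Pi.sub_apply]
    exact (abs_sub _ _).trans (add_le_add (hrE β z' κ u) (hrB β z' κ u))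
  rw [contact_lambda_eq_cells hL hrr hc hδ hCc hdiv hlE hlEs hlB hlBs hrE hrEs hrB hrBs hwE hwB hLg hRg hWg hlamW,
    cellLambda_eq_sum_bracket_mul_commutator hL hrr hc hδ (R := rE β z') (hrEs β z') (W := wE κ' u') (hwE κ' u') hgL,
    cellLambda_eq_sum_bracket_mul_commutator hL hrr hc hδ (R := lB α x') (hlBs α x') (W := wE κ' u') (hwE κ' u') hgR]

end Cell

/-! ## §5 The bracket against a TENT coefficient: the index leg climbs one level (`⟨W, 𝒬ᵀΦ⟩ = ⟨𝒬 W, Φ⟩`) -/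

section Tent

variable {L : ℕ} [NeZero L]

/-- [folklore] **THE BRACKET OF A TENT COEFFICIENT** (`KKTFluctuationEnergy.lip1_contourSumAdj`): if the coefficient is `γ` times the `L`-contour-sum
adjoint of a bounded coarse family `Φ μ y` — the shape of road S3's `TaylorLamBracket.lamCoeffOf_KInv_eq_neg_contourSumAdj` and of the owner's
`RespStepEffectiveEL.lamCoeffK_KInvStep_E2_eq_neg_contourSumAdj` for every member of (E) — then for an index leg `W` summable in each direction
`Σ'_u Σ_κ W κ u · c μ y κ u = γ · Σ'_{y′} Σ_{κ′} Φ μ y κ′ y′ · (𝒬_L W)_{κ′}(y′)`: the bracket is the straight block sum of the index leg paired with `Φ`. -/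
theorem bracket_eq_of_tent {c : Fin (d + 1) → (Fin (d + 1) → ℤ) → Fin (d + 1) → (Fin (d + 1) → ℤ) → ℝ}
    {Φ : Fin (d + 1) → (Fin (d + 1) → ℤ) → Form1 (d + 1) ℝ} {γ M : ℝ}
    (hcΦ : ∀ μ y κ u, c μ y κ u = γ * AffineReproduction.contourSumAdj L (Φ μ y) κ u) (hΦ : ∀ μ y κ' y', |Φ μ y κ' y'| ≤ M)
    {W : Form1 (d + 1) ℝ} (hWs : ∀ κ, Summable (W κ)) (μ : Fin (d + 1)) (y : Fin (d + 1) → ℤ) :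
    ∑' u, ∑ κ, W κ u * c μ y κ u = γ * ∑' y', ∑ κ', Φ μ y κ' y' * contourSum L W κ' y' := by
  have h := KKTFluctuationEnergy.lip1_contourSumAdj (N := L) hWs (hΦ μ y)
  unfold KKTFluctuationEnergy.lip1 at h
  rw [← h, ← tsum_mul_left]
  refine tsum_congr fun u => ?_
  rw [Finset.mul_sum]
  exact Finset.sum_congr rfl fun κ _ => by rw [hcΦ]; ring

end Tent

end Summit.QuantumFields.BalabanUV.Beta.GAN24.ContactLambdaCellFactorised

end
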